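import Summits.NavierStokesRegularity.NavierStokesRegularity.Theorems.HubbleDynamoNoSelfExcitedDynamoReduction
import Literature.Analysis.FluidPDE.ClassicalSolutionGlue
import HarnessLib

/-!
# Crux `NoSelfExcitedDynamo` (stmt-NavierStokesRegularity-1934), line `registered`: the physical time
  shift read in similarity variables

Theorems file (lands `--supports stmt-NavierStokesRegularity-1934`; registered sub-goal
`stub_pastShift`). For an eternal classical solution `(U, P)` of Leray's backward system
`∂ₛU + ½U + ½(y·∇)U + (U·∇)U + ∇P = ΔU`, `div U = 0` on `ℝ × ℝ³` in the uniform profile class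
`(1 + ‖y‖)^{k+1}‖DᵏU(s, y)‖ ≤ K_k` and a lag `τ > 0`, the physical field
`u = ofLerayOrbit U` (a classical unforced Navier–Stokes solution on `(−∞, 0) × ℝ³`, dictionary
`isClassicalNSSolutionOn_Iio_ofLerayOrbit_iff`) is shifted in time, `v(t) = u(t − τ)` (the system is
autonomous, `IsClassicalNSSolutionOn.comp_add_right`; `v` is classical on `(−∞, τ) ⊇ (−∞, 0)`), and
read back in similarity variables, `V = lerayOrbit v` (dictionary
`isClassicalNSSolutionOn_Iio_iff_isBackwardLeraySolutionOn`). Explicitly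

  `V(s, y) = θ • U(s′, θ • y)`,  `θ = e^{−s/2}/√(e^{−s} + τ) ∈ (0, 1]`,  `s′ = −log(e^{−s} + τ) ≤ −log τ`

(`pastShift_slice`), whence: `V` is again in the uniform profile class with the SAME constants
(`DᵏV(s) = θ^{k+1} DᵏU(s′)(θ ·)` and `θ(1 + ‖y‖) ≤ 1 + θ‖y‖`); its amplitude is bounded by the
amplitude of `U` on the half-line `s′ ≤ −log τ`; it switches off like `K₀ τ^{−1/2} e^{−s/2}` when
`‖U‖ ≤ K₀` (`θ ≤ e^{−s/2}/√τ`); and `V ≡ 0` forces `u ≡ 0` on `t < −τ`, i.e. `U(s) ≡ 0` for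
`s < −log τ`.
-/

noncomputable section

-- the mandated stub namespace repeats `NavierStokesRegularity` (tree precedent for this crux's stubs)
set_option linter.dupNamespace false

namespace Summit.NavierStokesRegularity.NavierStokesRegularity.Theorems.NoSelfExcitedDynamo.Registered

open Set MeasureTheory Filter Topology
open scoped ContDiff
open Literature.Analysis.FluidPDE

/-! ### The shifted profile in closed form -/

/-- **The time-shifted profile in closed form.** For any profile `U` and lag `τ`, the similarity
transform of the time shift `t ↦ ofLerayOrbit U (t − τ)` of its physical field is
`V(s, y) = θ • U(s′, θ • y)` with `θ = e^{−s/2} (√(e^{−s} + τ))⁻¹`, `s′ = −log(e^{−s} + τ)`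
(pure unfolding of `lerayOrbit` / `ofLerayOrbit`: `−(−e^{−s} − τ) = e^{−s} + τ`). -/
theorem pastShift_slice (U : ℝ → EuclideanSpace ℝ (Fin 3) → EuclideanSpace ℝ (Fin 3)) (τ s : ℝ)
    (y : EuclideanSpace ℝ (Fin 3)) :
    lerayOrbit (fun t => ofLerayOrbit U (t + -τ)) s y =
      (Real.exp (-s / 2) * (Real.sqrt (Real.exp (-s) + τ))⁻¹) •
        U (-Real.log (Real.exp (-s) + τ))
          ((Real.exp (-s / 2) * (Real.sqrt (Real.exp (-s) + τ))⁻¹) • y) := by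
  have hT : -(-Real.exp (-s) + -τ) = Real.exp (-s) + τ := by ring
  simp only [lerayOrbit_apply, ofLerayOrbit_apply, hT, smul_smul]
  rw [mul_comm (Real.sqrt (Real.exp (-s) + τ))⁻¹ (Real.exp (-s / 2))]

/-- The dilation factor `θ = e^{−s/2} (√(e^{−s} + τ))⁻¹` is positive for `τ > 0`. -/
theorem pastShift_theta_pos {τ : ℝ} (hτ : 0 < τ) (s : ℝ) :
    0 < Real.exp (-s / 2) * (Real.sqrt (Real.exp (-s) + τ))⁻¹ :=
  mul_pos (Real.exp_pos _) (inv_pos.2 (Real.sqrt_pos.2 (add_pos (Real.exp_pos _) hτ)))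

/-- The dilation factor is at most one: `e^{−s/2} = √(e^{−s}) ≤ √(e^{−s} + τ)` for `τ > 0`. -/
theorem pastShift_theta_le_one {τ : ℝ} (hτ : 0 < τ) (s : ℝ) :
    Real.exp (-s / 2) * (Real.sqrt (Real.exp (-s) + τ))⁻¹ ≤ 1 := by
  have hle : Real.exp (-s / 2) ≤ Real.sqrt (Real.exp (-s) + τ) := by
    rw [← sqrt_exp_neg]
    exact Real.sqrt_le_sqrt (by linarith)
  exact mul_inv_le_one_of_le₀ hle (Real.sqrt_nonneg _)

/-- The dilation factor switches off: `e^{−s/2} (√(e^{−s} + τ))⁻¹ ≤ e^{−s/2} (√τ)⁻¹` for `τ > 0`. -/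
theorem pastShift_theta_le {τ : ℝ} (hτ : 0 < τ) (s : ℝ) :
    Real.exp (-s / 2) * (Real.sqrt (Real.exp (-s) + τ))⁻¹ ≤ Real.exp (-s / 2) * (Real.sqrt τ)⁻¹ :=
  mul_le_mul_of_nonneg_left
    (inv_anti₀ (Real.sqrt_pos.2 hτ) (Real.sqrt_le_sqrt (by linarith [Real.exp_pos (-s)])))
    (Real.exp_pos _).le

/-- The shifted similarity time lies on the half-line: `−log(e^{−s} + τ) ≤ −log τ` for `τ > 0`. -/
theorem pastShift_time_le {τ : ℝ} (hτ : 0 < τ) (s : ℝ) :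
    -Real.log (Real.exp (-s) + τ) ≤ -Real.log τ :=
  neg_le_neg (Real.log_le_log hτ (by linarith [Real.exp_pos (-s)]))

/-- **Higher derivatives of a dilated slice**: for a `C^k` map `W` and a scalar `c`,
`Dᵏ(z ↦ c • W(c • z))(y) = c^{k+1} • DᵏW(c • y)` (Mathlib `iteratedFDeriv_const_smul_apply'`,
`iteratedFDeriv_comp_const_smul`). -/
theorem pastShift_iteratedFDeriv_dilate {F : Type*} [NormedAddCommGroup F] [NormedSpace ℝ F]
    {W : EuclideanSpace ℝ (Fin 3) → F} {k : ℕ} (hW : ContDiff ℝ k W) (c : ℝ)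
    (y : EuclideanSpace ℝ (Fin 3)) :
    iteratedFDeriv ℝ k (fun z => c • W (c • z)) y = c ^ (k + 1) • iteratedFDeriv ℝ k W (c • y) := by
  have hg : ContDiff ℝ k (fun z : EuclideanSpace ℝ (Fin 3) => W (c • z)) :=
    hW.comp (contDiff_const_smul _)
  rw [iteratedFDeriv_const_smul_apply' hg.contDiffAt, iteratedFDeriv_comp_const_smul _ hW, smul_smul,
    ← pow_succ']

/-- **The time shift is a classical solution on the past.** If `(U, P)` solves the backward Leray
system on `ℝ × ℝ³`, then the time shift `t ↦ (ofLerayOrbit U (t − τ), ofLerayOrbitPressure P (t − τ))`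
of its physical field by a lag `τ > 0` is a classical unforced Navier–Stokes solution on
`(−∞, 0) × ℝ³` (dictionary `isClassicalNSSolutionOn_Iio_ofLerayOrbit_iff`, autonomy
`IsClassicalNSSolutionOn.comp_add_right`, restriction from `(−∞, τ)` to `(−∞, 0)`). -/
theorem pastShift_isClassicalNSSolutionOn {U : ℝ → EuclideanSpace ℝ (Fin 3) → EuclideanSpace ℝ (Fin 3)}
    {P : ℝ → EuclideanSpace ℝ (Fin 3) → ℝ} (hL : IsBackwardLeraySolutionOn univ 1 U P) {τ : ℝ}
    (hτ : 0 < τ) :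
    IsClassicalNSSolutionOn (Iio 0) 1 0 (fun t => ofLerayOrbit U (t + -τ))
      (fun t => ofLerayOrbitPressure P (t + -τ)) := by
  have hcl : IsClassicalNSSolutionOn (Iio 0) 1 0 (ofLerayOrbit U) (ofLerayOrbitPressure P) :=
    isClassicalNSSolutionOn_Iio_ofLerayOrbit_iff.2 hL
  have hsub : Iio (0 : ℝ) ⊆ (· + -τ) ⁻¹' Iio 0 := fun t ht => by
    simp only [mem_preimage, mem_Iio] at ht ⊢
    linarith
  exact (hcl.comp_add_right (-τ)).mono hsub (uniqueDiffOn_Iio 0)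

/-! ### The registered sub-goal -/

/-- **The physical time shift read in similarity variables** (registered sub-goal `stub_pastShift`).
For an eternal classical solution `(U, P)` of Leray's backward system on `ℝ × ℝ³` in the uniform
profile class and a lag `τ > 0`, the profile `V = lerayOrbit (t ↦ ofLerayOrbit U (t − τ))` of the
time-shifted physical field (with the pressure `Q = lerayOrbitPressure (t ↦ ofLerayOrbitPressure P (t − τ))`)
is again an eternal solution in the uniform profile class (same constants); its amplitude is bounded
by the amplitude of `U` on the half-line `s ≤ −log τ`; it switches off like `K₀ τ^{−1/2} e^{−s/2}`
when `‖U‖ ≤ K₀`; and `V ≡ 0` forces `U(s, ·) ≡ 0` for every `s < −log τ`. All four clauses are read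
off the closed form `V(s, y) = θ • U(s′, θ • y)`, `θ = e^{−s/2}/√(e^{−s} + τ) ≤ 1`,
`s′ = −log(e^{−s} + τ) ≤ −log τ` (`pastShift_slice`), and the inversion `ofLerayOrbit ∘ lerayOrbit = id`
on the past. -/
theorem stub_pastShift :
    ∀ (U : ℝ → EuclideanSpace ℝ (Fin 3) → EuclideanSpace ℝ (Fin 3)) (P : ℝ → EuclideanSpace ℝ (Fin 3) → ℝ),
      IsBackwardLeraySolutionOn univ 1 U P →
      (∀ k : ℕ, ∃ K : ℝ, ∀ s y, (1 + ‖y‖) ^ (k + 1) * ‖iteratedFDeriv ℝ k (U s) y‖ ≤ K) →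
      ∀ τ : ℝ, 0 < τ →
        ∃ (V : ℝ → EuclideanSpace ℝ (Fin 3) → EuclideanSpace ℝ (Fin 3)) (Q : ℝ → EuclideanSpace ℝ (Fin 3) → ℝ),
          IsBackwardLeraySolutionOn univ 1 V Q ∧
          (∀ k : ℕ, ∃ K : ℝ, ∀ s y, (1 + ‖y‖) ^ (k + 1) * ‖iteratedFDeriv ℝ k (V s) y‖ ≤ K) ∧
          (∀ A : ℝ, (∀ s ≤ -Real.log τ, ∀ y, ‖U s y‖ ≤ A) → ∀ s y, ‖V s y‖ ≤ A) ∧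
          (∀ K₀ : ℝ, (∀ s y, ‖U s y‖ ≤ K₀) → ∀ s y, ‖V s y‖ ≤ K₀ * (Real.sqrt τ)⁻¹ * Real.exp (-s / 2)) ∧
          ((∀ s y, V s y = 0) → ∀ s < -Real.log τ, ∀ y, U s y = 0) := by
  intro U P hL hprof τ hτ
  refine ⟨lerayOrbit fun t => ofLerayOrbit U (t + -τ),
    lerayOrbitPressure fun t => ofLerayOrbitPressure P (t + -τ),
    isClassicalNSSolutionOn_Iio_iff_isBackwardLeraySolutionOn.1 (pastShift_isClassicalNSSolutionOn hL hτ),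
    fun k => ?_, fun A hA s y => ?_, fun K₀ hK₀ s y => ?_, fun hzero s hs y => ?_⟩
  · -- the uniform profile class, with the same constants
    obtain ⟨K, hK⟩ := hprof k
    refine ⟨K, fun s y => ?_⟩
    set θ : ℝ := Real.exp (-s / 2) * (Real.sqrt (Real.exp (-s) + τ))⁻¹ with hθ_def
    set s' : ℝ := -Real.log (Real.exp (-s) + τ) with hs'_def
    have hθ0 : 0 ≤ θ := (pastShift_theta_pos hτ s).le
    have hθ1 : θ ≤ 1 := pastShift_theta_le_one hτ s
    have hslice : lerayOrbit (fun t => ofLerayOrbit U (t + -τ)) s = fun z => θ • U s' (θ • z) :=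
      funext fun z => pastShift_slice U τ s z
    have hUk : ContDiff ℝ k (U s') :=
      (hL.contDiff_velocity (mem_univ _)).of_le (by exact_mod_cast le_top)
    rw [hslice, pastShift_iteratedFDeriv_dilate hUk θ y, norm_smul, norm_pow, Real.norm_of_nonneg hθ0]
    have hle : θ * (1 + ‖y‖) ≤ 1 + ‖θ • y‖ := by
      rw [norm_smul, Real.norm_of_nonneg hθ0, mul_add, mul_one]
      linarith
    calc (1 + ‖y‖) ^ (k + 1) * (θ ^ (k + 1) * ‖iteratedFDeriv ℝ k (U s') (θ • y)‖)
        = (θ * (1 + ‖y‖)) ^ (k + 1) * ‖iteratedFDeriv ℝ k (U s') (θ • y)‖ := by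
          rw [mul_pow θ (1 + ‖y‖) (k + 1)]; ring
      _ ≤ (1 + ‖θ • y‖) ^ (k + 1) * ‖iteratedFDeriv ℝ k (U s') (θ • y)‖ :=
          mul_le_mul_of_nonneg_right (pow_le_pow_left₀ (by positivity) hle _) (norm_nonneg _)
      _ ≤ K := hK s' (θ • y)
  · -- the amplitude is that of `U` on the half-line `s' ≤ -log τ`
    have hθ0 : 0 ≤ Real.exp (-s / 2) * (Real.sqrt (Real.exp (-s) + τ))⁻¹ := (pastShift_theta_pos hτ s).le
    rw [pastShift_slice, norm_smul, Real.norm_of_nonneg hθ0]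
    calc Real.exp (-s / 2) * (Real.sqrt (Real.exp (-s) + τ))⁻¹ *
          ‖U (-Real.log (Real.exp (-s) + τ))
            ((Real.exp (-s / 2) * (Real.sqrt (Real.exp (-s) + τ))⁻¹) • y)‖
        ≤ 1 * ‖U (-Real.log (Real.exp (-s) + τ))
            ((Real.exp (-s / 2) * (Real.sqrt (Real.exp (-s) + τ))⁻¹) • y)‖ :=
          mul_le_mul_of_nonneg_right (pastShift_theta_le_one hτ s) (norm_nonneg _)
      _ ≤ A := by
          rw [one_mul]
          exact hA _ (pastShift_time_le hτ s) _
  · -- forward switch-off like `K₀ τ^{-1/2} e^{-s/2}`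
    have hθ0 : 0 ≤ Real.exp (-s / 2) * (Real.sqrt (Real.exp (-s) + τ))⁻¹ := (pastShift_theta_pos hτ s).le
    have hK₀0 : 0 ≤ K₀ := (norm_nonneg _).trans (hK₀ 0 0)
    rw [pastShift_slice, norm_smul, Real.norm_of_nonneg hθ0]
    calc Real.exp (-s / 2) * (Real.sqrt (Real.exp (-s) + τ))⁻¹ *
          ‖U (-Real.log (Real.exp (-s) + τ))
            ((Real.exp (-s / 2) * (Real.sqrt (Real.exp (-s) + τ))⁻¹) • y)‖
        ≤ Real.exp (-s / 2) * (Real.sqrt (Real.exp (-s) + τ))⁻¹ * K₀ :=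
          mul_le_mul_of_nonneg_left (hK₀ _ _) hθ0
      _ ≤ Real.exp (-s / 2) * (Real.sqrt τ)⁻¹ * K₀ :=
          mul_le_mul_of_nonneg_right (pastShift_theta_le hτ s) hK₀0
      _ = K₀ * (Real.sqrt τ)⁻¹ * Real.exp (-s / 2) := by ring
  · -- return ticket: `V ≡ 0` forces `U(s) ≡ 0` for `s < -log τ`
    -- the shifted physical field vanishes on the past
    have hvt : ∀ t < 0, ∀ x, ofLerayOrbit U (t + -τ) x = 0 := by
      intro t ht x
      have key := eq_lerayOrbit_of_neg (fun t => ofLerayOrbit U (t + -τ)) ht x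
      rw [hzero, smul_zero] at key
      exact key
    -- `-e^{-s} + τ < 0` exactly when `s < -log τ`
    have hτs : τ < Real.exp (-s) := by
      have h := Real.exp_lt_exp.2 (show Real.log τ < -s by linarith)
      rwa [Real.exp_log hτ] at h
    have ht : -Real.exp (-s) + τ < 0 := by linarith
    have e : U s y = lerayOrbit (ofLerayOrbit U) s y := by rw [lerayOrbit_ofLerayOrbit_eq]
    have h0 := hvt _ ht (Real.exp (-s / 2) • y)
    rw [show -Real.exp (-s) + τ + -τ = -Real.exp (-s) by ring] at h0
    rw [e, lerayOrbit_apply, h0, smul_zero]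

end Summit.NavierStokesRegularity.NavierStokesRegularity.Theorems.NoSelfExcitedDynamo.Registered

end
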